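import Literature.MathematicalPhysics.QuantumLattice.HubbardNNNHoppingPlaquetteFluxGauge
import Literature.MathematicalPhysics.QuantumLattice.FockRelabel
import HarnessLib

/-!
# Magnetic translations of the plaquette-flux `t–t'` torus as OPERATORS: the translation unitaries act on
# the gauge field, `T_{e₂}` commutes with `H_m`, and `W_g T_{−e₁}` (translation × gauge phase) commutes with `H_m`

Topic `Literature/MathematicalPhysics/QuantumLattice` (namespace = path; family `hubbard`). Sequel of
`HubbardNNNHoppingPlaquetteFlux(Gauge).lean` (the `t–t'–U` torus `hubbardTorusTT'Plaquette L t' U m` in the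
uniform orbital field of flux `2πm/L` per plaquette, Landau gauge; the lattice-gauge identities
`landauGauge_shift_zero/one`, `landauDiagAmp_shift_zero/one`) and of `FockRelabel.lean` (the translation
unitaries `T_v = fockTranslate v`, `relabel (Orb.translate v) a = T_v a T_vᴴ`). Here the lattice-gauge content of
Zak's magnetic translations becomes an OPERATOR statement on Fock space — the finite-volume input of any
thermodynamic-limit treatment of the orbital-flux row (the cell's FL4): the Landau-gauge Hamiltonian is NOT
translation invariant along `e₁`, but it commutes with the magnetic translation `W_g T_{−e₁}`,
`g(x) = χ(−m x₂)`, and with the plain translation `T_{e₂}`. Everything is PROVED; no definition, no named fact.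

## Contents

* GENERAL (any gauge field / any diagonal amplitudes): `relabel_translate_magneticHubbardTorus`
  (`T_v H_A T_vᴴ = H_{A(· − v)}`) and `relabel_translate_diagPeierlsHopping` (`T_v D_a T_vᴴ = D_{a(· − v)}`) — the
  translation unitaries transport the Peierls data.
* `relabel_translate_e2_hubbardTorusTT'Plaquette`: `T_{e₂} H_m T_{e₂}ᴴ = H_m`; `fockTranslate_e2_commute_…`.
* **`relabel_translate_neg_e1_hubbardTorusTT'Plaquette`: `T_{−e₁} H_m T_{−e₁}ᴴ = W_gᴴ H_m W_g`**, `W_g = phaseGauge g`,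
  `g(x) = χ(−m x₂)`; hence **`magneticTranslate_commute_hubbardTorusTT'Plaquette`: `[W_g T_{−e₁}, H_m] = 0`**
  (Zak's magnetic translation is a symmetry).

HONEST SCOPE: finite-volume symmetry bookkeeping; no number, no thermodynamic limit, nothing about
superconductivity.

## References
* J. Zak, Phys. Rev. 134 (1964) A1602, §2 (magnetic translation operators commute with the Hamiltonian in a
  uniform field). [cite: Zak1964, §2]
* O. Bratteli, D. W. Robinson, *Operator Algebras and Quantum Statistical Mechanics II* (1997), §5.2.2,
  Thm. 5.2.5 (Bogoliubov automorphisms implemented by unitaries). [cite: BratteliRobinsonII1997, §5.2.2, Thm. 5.2.5]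
* D. R. Hofstadter, Phys. Rev. B 14 (1976) 2239, §II. [cite: Hofstadter1976, §II]
-/

noncomputable section

namespace Literature.MathematicalPhysics.QuantumLattice

open _root_.Matrix Finset Literature.MathematicalPhysics.QuantumFieldTheory HubbardWave0
open scoped ComplexConjugate

variable (L : ℕ) [NeZero L]

/-! ### Translations transport the Peierls data -/

/-- **`T_v H_A(t,U) T_vᴴ = H_{A(·−v)}(t,U)`**: translating the Peierls-coupled Hubbard torus by `v` translates
its gauge field (`T_v c_{x} T_vᴴ = c_{x+v}`, then re-index the site sum).
[cite: BratteliRobinsonII1997, §5.2.2, Thm. 5.2.5] -/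
theorem relabel_translate_magneticHubbardTorus (v : Site 2 L) (A : GaugeConfig 2 L Circle) (t U : ℝ) :
    relabel (Orb.translate v) (magneticHubbardTorus L A t U) =
      magneticHubbardTorus L (fun e => A (e.1 - v, e.2)) t U := by
  unfold magneticHubbardTorus
  rw [relabel_add, relabel_smul, relabel_smul, relabel_sum, relabel_sum]
  refine congrArg₂ (· + ·) (congrArg (fun S => (-(t : ℂ)) • S) ?_) (congrArg (fun S => ((U : ℝ) : ℂ) • S) ?_)
  · refine Fintype.sum_equiv (Equiv.addRight v) _ _ fun x => ?_
    simp only [Equiv.coe_addRight]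
    rw [relabel_sum]
    refine Finset.sum_congr rfl fun i _ => ?_
    rw [relabel_sum]
    refine Finset.sum_congr rfl fun σ _ => ?_
    rw [relabel_add, relabel_smul, relabel_smul, relabel_mul, relabel_mul, relabel_translate_creation,
      relabel_translate_annihilation, relabel_translate_creation, relabel_translate_annihilation, add_sub_cancel_right,
      show Site.shift x i + v = Site.shift (x + v) i from add_right_comm _ _ _]
  · rw [show Orb.translate v = Orb.mapEquiv (FermionTorus.ofTorusEquiv (Equiv.addRight v)) from rfl]
    simp_rw [relabel_mul, relabel_mapEquiv_numberOp]
    exact Equiv.sum_comp (FermionTorus.ofTorusEquiv (Equiv.addRight v)) (fun y => numberOp y 0 * numberOp y 1)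

/-- **`T_v D_a T_vᴴ = D_{a(·−v)}`** for the diagonal Peierls bond sum. [cite: BratteliRobinsonII1997, §5.2.2, Thm. 5.2.5] -/
theorem relabel_translate_diagPeierlsHopping (v : Site 2 L) (a : Fin 2 → Site 2 L → ℂ) :
    relabel (Orb.translate v) (diagPeierlsHopping L a) = diagPeierlsHopping L (fun s x => a s (x - v)) := by
  unfold diagPeierlsHopping
  rw [relabel_sum]
  refine Finset.sum_congr rfl fun s _ => ?_
  rw [relabel_sum]
  refine Fintype.sum_equiv (Equiv.addRight v) _ _ fun x => ?_
  simp only [Equiv.coe_addRight]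
  rw [relabel_sum]
  refine Finset.sum_congr rfl fun σ _ => ?_
  rw [relabel_add, relabel_smul, relabel_smul, relabel_mul, relabel_mul, relabel_translate_creation,
    relabel_translate_annihilation, relabel_translate_creation, relabel_translate_annihilation, add_sub_cancel_right,
    show x + torusDiagJump L s + v = x + v + torusDiagJump L s from add_right_comm _ _ _]

/-! ### `T_{e₂}` is a symmetry of the Landau-gauge Hamiltonian -/

omit [NeZero L] in
/-- Subtracting `e₂` does not change `x₁`. [folklore] -/
private theorem sub_single_one_apply_zero (x : Site 2 L) : (x - (Pi.single 1 1 : Site 2 L)) 0 = x 0 := by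
  simp

/-- The Landau field is invariant under `x ↦ x − e₂`. [cite: Hofstadter1976, §II] -/
theorem landauGauge_sub_single_one (m : ℤ) (e : Edge 2 L) :
    landauGauge L m (e.1 - (Pi.single 1 1 : Site 2 L), e.2) = landauGauge L m e := by
  obtain ⟨x, i⟩ := e
  unfold landauGauge
  simp only [sub_single_one_apply_zero]

/-- The diagonal Landau phases are invariant under `x ↦ x − e₂`. [cite: Hofstadter1976, §II] -/
theorem landauDiagAmp_sub_single_one (m : ℤ) (s : Fin 2) (x : Site 2 L) :
    landauDiagAmp L m s (x - (Pi.single 1 1 : Site 2 L)) = landauDiagAmp L m s x := by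
  simp only [landauDiagAmp, sub_single_one_apply_zero]

/-- **`T_{e₂} H_m T_{e₂}ᴴ = H_m`**: the plaquette-flux torus in the Landau gauge is invariant under
translation along `e₂`. [cite: Zak1964, §2] -/
theorem relabel_translate_e2_hubbardTorusTT'Plaquette (t' U : ℝ) (m : ℤ) :
    relabel (Orb.translate (Pi.single 1 1 : Site 2 L)) (hubbardTorusTT'Plaquette L t' U m) =
      hubbardTorusTT'Plaquette L t' U m := by
  rw [hubbardTorusTT'Plaquette, relabel_add, relabel_smul, relabel_translate_magneticHubbardTorus,
    relabel_translate_diagPeierlsHopping,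
    show (fun e : Edge 2 L => landauGauge L m (e.1 - (Pi.single 1 1 : Site 2 L), e.2)) = landauGauge L m from
      funext fun e => landauGauge_sub_single_one L m e,
    show (fun (s : Fin 2) (x : Site 2 L) => landauDiagAmp L m s (x - (Pi.single 1 1 : Site 2 L))) = landauDiagAmp L m from
      funext fun s => funext fun x => landauDiagAmp_sub_single_one L m s x]

/-- `[T_{e₂}, H_m] = 0`. [cite: Zak1964, §2] -/
theorem fockTranslate_e2_commute_hubbardTorusTT'Plaquette (t' U : ℝ) (m : ℤ) :
    Commute (fockTranslate (Pi.single 1 1 : Site 2 L)).val (hubbardTorusTT'Plaquette L t' U m) :=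
  fockRelabel_commute_of_relabel_eq _ (relabel_translate_e2_hubbardTorusTT'Plaquette L t' U m)

/-! ### The magnetic translation along `e₁` -/

omit [NeZero L] in
/-- `x − (−e₁) = x + e₁ = x.shift 0`. [folklore] -/
private theorem sub_neg_single_zero (x : Site 2 L) : x - -(Pi.single 0 1 : Site 2 L) = Site.shift x 0 := by
  rw [sub_neg_eq_add]
  rfl

/-- Translating the Landau field by `−e₁` is the gauge transformation by `x ↦ χ(−m x₂)`.
[cite: Zak1964, §2] -/
theorem landauGauge_sub_neg_single_zero (m : ℤ) :
    (fun e : Edge 2 L => landauGauge L m (e.1 - -(Pi.single 0 1 : Site 2 L), e.2)) =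
      gaugeTransform (fun y : Site 2 L => ZMod.toCircle (-((m : ZMod L) * y 1))) (landauGauge L m) := by
  funext e
  obtain ⟨x, i⟩ := e
  simp only [sub_neg_single_zero]
  exact landauGauge_shift_zero L m x i

/-- Translating the diagonal Landau phases by `−e₁` conjugates them by the same gauge. [cite: Zak1964, §2] -/
theorem landauDiagAmp_sub_neg_single_zero (m : ℤ) :
    (fun (s : Fin 2) (x : Site 2 L) => landauDiagAmp L m s (x - -(Pi.single 0 1 : Site 2 L))) =
      fun s x => ((ZMod.toCircle (-((m : ZMod L) * x 1)) : Circle) : ℂ) * landauDiagAmp L m s x *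
        conj ((ZMod.toCircle (-((m : ZMod L) * (x + torusDiagJump L s) 1)) : Circle) : ℂ) := by
  funext s x
  simp only [sub_neg_single_zero]
  exact landauDiagAmp_shift_zero L m s x

/-- **`T_{−e₁} H_m T_{−e₁}ᴴ = W_gᴴ H_m W_g`** with `W_g = phaseGauge g`, `g(x) = χ(−m x₂)`: translating the
Landau-gauge Hamiltonian along `e₁` is undone by a site-phase gauge transformation. [cite: Zak1964, §2] -/
theorem relabel_translate_neg_e1_hubbardTorusTT'Plaquette (t' U : ℝ) (m : ℤ) :
    relabel (Orb.translate (-(Pi.single 0 1 : Site 2 L))) (hubbardTorusTT'Plaquette L t' U m) =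
      (phaseGauge fun u : FermionTorus 2 L => ZMod.toCircle (-((m : ZMod L) * u.toTorusSite 1)))ᴴ *
        hubbardTorusTT'Plaquette L t' U m *
        phaseGauge (fun u : FermionTorus 2 L => ZMod.toCircle (-((m : ZMod L) * u.toTorusSite 1))) := by
  have key := conjTranspose_phaseGauge_mul_diagPeierlsHopping_mul_phaseGauge (L := L)
    (fun y : Site 2 L => ZMod.toCircle (-((m : ZMod L) * y 1))) (landauDiagAmp L m)
  beta_reduce at key
  rw [hubbardTorusTT'Plaquette, relabel_add, relabel_smul, relabel_translate_magneticHubbardTorus,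
    relabel_translate_diagPeierlsHopping, landauGauge_sub_neg_single_zero, landauDiagAmp_sub_neg_single_zero,
    magneticHubbardTorus_gaugeTransform, Matrix.mul_add, Matrix.add_mul, Matrix.mul_smul, Matrix.smul_mul, ← key]

/-- Matrix bookkeeping: `T H Tᴴ = Wᴴ H W` with `Tᴴ T = 1`, `W Wᴴ = 1` gives `[W T, H] = 0`. [folklore] -/
private theorem commute_mul_of_conj_eq {Λ : Type*} [LinearOrder Λ] [Fintype Λ]
    {T W H : Matrix (Finset (Orb Λ)) (Finset (Orb Λ)) ℂ}
    (hrel : T * H * Tᴴ = Wᴴ * H * W) (hTT : Tᴴ * T = 1) (hWW : W * Wᴴ = 1) : Commute (W * T) H := by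
  have h1 : T * H = Wᴴ * H * W * T := by
    calc T * H = T * H * (Tᴴ * T) := by rw [hTT, Matrix.mul_one]
      _ = T * H * Tᴴ * T := by rw [← Matrix.mul_assoc]
      _ = Wᴴ * H * W * T := by rw [hrel]
  show W * T * H = H * (W * T)
  calc W * T * H = W * (T * H) := Matrix.mul_assoc _ _ _
    _ = W * (Wᴴ * H * W * T) := by rw [h1]
    _ = W * Wᴴ * H * W * T := by simp only [Matrix.mul_assoc]
    _ = H * (W * T) := by rw [hWW, Matrix.one_mul, Matrix.mul_assoc]

/-- **Zak's magnetic translation is a symmetry**: the unitary `M₁ = W_g · T_{−e₁}` (`g(x) = χ(−m x₂)`) commutes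
with the plaquette-flux torus in the Landau gauge, `[M₁, H_m] = 0`. [cite: Zak1964, §2] -/
theorem magneticTranslate_commute_hubbardTorusTT'Plaquette (t' U : ℝ) (m : ℤ) :
    Commute
      (phaseGauge (fun u : FermionTorus 2 L => ZMod.toCircle (-((m : ZMod L) * u.toTorusSite 1))) *
        (fockTranslate (-(Pi.single 0 1 : Site 2 L))).val)
      (hubbardTorusTT'Plaquette L t' U m) := by
  have hrel := relabel_translate_neg_e1_hubbardTorusTT'Plaquette L t' U m
  rw [relabel_eq_fockRelabel_conj] at hrel
  refine commute_mul_of_conj_eq hrel ?_ (phaseGauge_mul_conjTranspose_self _)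
  exact fockRelabel_conjTranspose_mul_self _

end Literature.MathematicalPhysics.QuantumLattice
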